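import Summits.BirchSwinnertonDyer.BirchSwinnertonDyer.Theorems.PrintCf2SplitBadTwoKummerProNullDischarge
import Summits.BirchSwinnertonDyer.BirchSwinnertonDyer.Theorems.PrintCf2SplitBadTwoLayerDualShapiroLocal
import Literature.NumberTheory.GaloisRepresentations.DecompositionFieldRigidity
import HarnessLib

/-!
# Crux `PrintCf2.SplitBadTwoRankOneOfFacts` (stmt-BirchSwinnertonDyer-20368), skeleton v13.5, (REG₂) `stub_xRegular_two` FACT-FREE road, R2 brick
# **B5-T-loc (FILE 5): THE LOCAL HALF OF THE TWISTED `v̄` READING** — for coefficients `ℤ/n(ε)` that are trivial on `D_v̄` (the SPLIT case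
# `ε|_{D_v̄} = 1` of -w4 g14's B5-T plan, STATUS 07:55:20Z), the dual-of-unramified condition at `v̄` of a class whose restriction to `D_v̄`
# is the Kummer cocycle of `ζ` forces `n ∣ ord_v̄(ι(ζⁿ))` for the element `ι(ζⁿ) ∈ K_v̄`

Cell `bsd-print-cf2`, EXTRA WIDTH seat `bsd-line-cf2-p1-w3` g14 (prover-bsd-line-cf2-p1-w3-g14-0); `--supports stmt-BirchSwinnertonDyer-20368`
(helper, Theses-free). HONEST FRAMING: nothing here closes the crux or a registered stub; BSD is not proved by any of this; no summit
statement is proved by this seat. No definition, no named fact, no `sorry`. UNCONDITIONAL.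

WHY (division of «B5-T» agreed on STATUS 08:1xZ: cohomological half -w4 g14, local half this seat). For the TWISTED dual levels `μ_{2^M}(ε)` the
norm trick to the base (FILE 1 p706643) is void (no `Γ_K`-fixed vector); -w4 g14's ρ_ε-probe pulls 6b's clause (iii) at `v̄` back to a class
`Y ∈ H¹(K, (ℤ/n(ε))^D)` with `loc_v̄ Y ⟂ H¹_ur(K_v̄, ℤ/n(ε))` whose restriction to `Gal(K̄/K_ε) ⊇ D_v̄` is the Kummer class of `z = N_{F′/K_ε}(b′) ∈ K_ε`.
In the split case `ε|_{D_v̄} = 1` the local module at `v̄` is the TRIVIAL `ℤ/n`, and this file reads the condition exactly as -w7 g6's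
`KummerProNull.dvd_log_valuation_of_mem_dualLocalCondition_unramifiedSubgroup` (p701967) does for globally trivial coefficients, but LOCALLY:
* **`dvd_log_valued_of_mem_dualLocalCondition_unramified_of_locallyTrivial`** — `ρ` on `ℤ/n` trivial on `res(Γ_{K_v̄})`, `φ` a `1`-cocycle of
  `Γ_K` in `(ℤ/n)^D` with `φ(res σ)(1) = res σ • ζ / ζ` on `Γ_{K_v̄}`, `ẑ ∈ K_v̄` with `ẑ = ι(ζⁿ)` in `\bar K_v̄` (`ι = absClosureEmbedding`; such `ẑ`
  exists as soon as `ζⁿ` is `D_v̄`-fixed, `mem_range_of_forall_absGaloisRestrict_smul_eq`): `loc_v̄ [φ] ∈ (H¹_ur)^⊥` (canonical pairing) ⟹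
  `(n : ℤ) ∣ log |ẑ|_v̄`. Steps: unramified test class `[χ]` (a cocycle since `ρ ∘ res = 1`); transport along `α = (c ↦ c·id)`, `β = ι_μ ∘ ev₁`
  (equivariant on `Γ_{K_v̄}` by local triviality), `H²(muLocalIso)`; the transported class of `loc_v̄ [φ]` IS `κₙ(ẑ)` (root `ι(ζ)`,
  `kummerClassHom_eq_of_pow_eq`); graded commutativity; `cupProduct_δ₀_scalarCocycle_eq_zero_iff_dvd_ord` (p700084) at the local field `K_v̄`.
NOT here (FILE 6): `|ẑ|_v̄ = |z|_{w₀}` for `z ∈ K_ε` at the place `w₀` below `𝔓₀` (`e(w₀∣v̄) = 1`). presearch: Serre *Local Fields* XIV §1 Prop. 3;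
NSW (1.4.2)/(1.4.4); folklore transport, no new fact. beyond-print theorem: no.

References: [SerreLocalFields1979] XIV §1 Prop. 3, X §3 b); [NeukirchSchmidtWingberg2008] I §4 (1.4.2), (1.4.4); [MilneADT2006] I §2 Thm. 2.6;
[NeukirchANT1999] Ch. II §9 (9.6).
-/

noncomputable section

set_option linter.dupNamespace false
set_option autoImplicit false

open scoped Classical WithZero ContRepresentation
open NumberField IsDedekindDomain Field ValuativeRel Function CategoryTheory
open _root_.ContinuousCohomology
open Literature.NumberTheory.GaloisRepresentations
open Literature.NumberTheory.GaloisRepresentations.DiscreteGaloisModule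
open Literature.NumberTheory.GaloisRepresentations.LocalWeilDatum Literature.NumberTheory.GaloisRepresentations.IsNonarchimedeanLocalField
open Literature.NumberTheory.GaloisCohomology
open Literature.AnabelianGeometry.AbsoluteAnabelian Literature.AnabelianGeometry.AbsoluteAnabelian.Prop121vii
open Summit.BirchSwinnertonDyer.BirchSwinnertonDyer.Theorems.PrintCf2.KummerProNull

namespace Summit.BirchSwinnertonDyer.BirchSwinnertonDyer.Theorems.PrintCf2.NormAtVbar

section Local

variable (K : Type) [Field K] [NumberField K] {n : ℕ} [NeZero n]

/-- **The dual of the unramified condition at a place where the coefficients are LOCALLY trivial, read on a locally-Kummer cocycle.**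
Let `ρ` be `ℤ/n` with ANY `Γ_K`-action which is TRIVIAL on the image of `Γ_{K_v̄}` (e.g. a quadratic twist `ε` with `ε|_{D_v̄} = 1`), `φ` a continuous
`1`-cocycle of `Γ_K` in `(ℤ/n)^D` whose values on `D_v̄ = res(Γ_{K_v̄})`, evaluated at `1`, are the Kummer cocycle of `ζ ∈ K̄ˣ`
(`φ(res σ)(1) = res σ • ζ / ζ`), and `zv ∈ K_v̄` the element with `zv = ι(ζⁿ)` under the chosen `ι : K̄ → \\bar K_v̄` (it exists: `ζⁿ` is
`D_v̄`-fixed, `mem_range_of_forall_absGaloisRestrict_smul_eq`). IF `loc_v̄ [φ]` lies in the canonical dual local condition of `H¹_ur(K_v̄, ρ)`, THEN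
`(n : ℤ) ∣ log |zv|_v̄` (`Valued.v` on `K_v̄`). Proof = -w7 g6's `dvd_log_valuation_of_mem_dualLocalCondition_unramifiedSubgroup` (p701967) run
LOCALLY: test class `[χ]` of the normalised unramified character; transport along `(c ↦ c·id, f ↦ f 1, muLocalIso)` (equivariant because `ρ`
is trivial on `Γ_{K_v̄}`); the transported class is the local Kummer class `κₙ(zv)` (`kummerClassHom_eq_of_pow_eq`, root `ι(ζ)`); graded
commutativity; (K-ū) `cupProduct_δ₀_scalarCocycle_eq_zero_iff_dvd_ord` (p700084) at the local field `K_v̄`. [cite: SerreLocalFields1979, XIV §1 Prop. 3]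
[cite: NeukirchSchmidtWingberg2008, I §4 (1.4.2), (1.4.4)] [cite: MilneADT2006, Ch. I §2 (Thm. 2.6)] -/
theorem dvd_log_valued_of_mem_dualLocalCondition_unramified_of_locallyTrivial (ρ : DiscreteGaloisModule K (ZMod n))
    (vbar : HeightOneSpectrum (𝓞 K))
    (hloc : ∀ (σ : absoluteGaloisGroup (vbar.adicCompletion K)) (m : ZMod n), ρ (absGaloisRestrict K (vbar.adicCompletion K) σ) m = m)
    (φY : contOneCocycles ((ρ.tateDual n).toTopRep))
    (hY : galoisCohomology.localization (ρ.tateDual n) (Sum.inr vbar) 1 (oneCocycleClass _ φY) ∈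
      (LocalInvariants.canonical K n).dualLocalCondition ρ (Sum.inr vbar) (unramifiedSubgroup (GaloisRep.toLocal vbar ρ) 1))
    (ζ : (AlgebraicClosure K)ˣ)
    (hread : ∀ σ : absoluteGaloisGroup (vbar.adicCompletion K),
      muVal K n ((φY.1 (absGaloisRestrict K (vbar.adicCompletion K) σ)) 1) = absGaloisRestrict K (vbar.adicCompletion K) σ • ζ / ζ)
    (zv : vbar.adicCompletion K) (hzv0 : zv ≠ 0)
    (hzv : algebraMap (vbar.adicCompletion K) (AlgebraicClosure (vbar.adicCompletion K)) zv =
      absClosureEmbedding K (vbar.adicCompletion K) ((ζ ^ n : (AlgebraicClosure K)ˣ) : AlgebraicClosure K)) :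
    (n : ℤ) ∣ WithZero.log (Valued.v zv) := by
  haveI hcz : CharZero (vbar.adicCompletion K) := charZero_adicCompletion vbar
  haveI : NeZero ((n : ℕ) : vbar.adicCompletion K) := ⟨by exact_mod_cast NeZero.ne n⟩
  haveI : CompactSpace (absoluteGaloisGroup (Place.Completion (Sum.inr vbar : Place K))) := absoluteGaloisGroup_compactSpace _
  haveI : CompactSpace (absoluteGaloisGroup (vbar.adicCompletion K)) := absoluteGaloisGroup_compactSpace _
  rcases Nat.lt_or_ge 1 n with hn1 | hn1
  swap
  · have hn : n = 1 := le_antisymm hn1 (NeZero.pos n)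
    subst hn
    exact ⟨_, by rw [Nat.cast_one, one_mul]⟩
  obtain ⟨χ, hIχ, hFχ, -, -⟩ := exists_normalizedCharacter (vbar.adicCompletion K) n hn1
  -- the unramified test class `t_χ = [σ ↦ χ σ] ∈ H¹(K_v̄, ℤ/n)` (ρ is trivial on `Γ_{K_v̄}`)
  let tχ : contOneCocycles (ρ.toLocal (Sum.inr vbar)).toTopRep :=
    ⟨⟨fun σ ↦ χ σ, χ.continuous⟩, fun σ τ ↦ by
      change χ (σ * τ) = χ σ + ρ (absGaloisRestrict K (vbar.adicCompletion K) σ) (χ τ)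
      exact (χ.map_mul σ τ).trans (congrArg (χ σ + ·) (hloc _ _).symm)⟩
  have htχ : oneCocycleClass _ tχ ∈ unramifiedSubgroup (GaloisRep.toLocal vbar ρ) 1 :=
    (Summit.BirchSwinnertonDyer.Rank1Residual.X11b.LocBridge.mem_unramifiedSubgroup_one_iff_forall_eq_zero
      (GaloisRep.toLocal vbar ρ) (fun τ _ m ↦ hloc _ m) tχ).mpr (fun τ hτ ↦ hIχ τ hτ)
  have hval := (LocalInvariants.mem_dualLocalCondition_iff _ _ _ _ _).mp hY _ htχ
  -- the three module maps along which the cup product is transported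
  let P₁ := tateDualPairingLocal ρ n (Sum.inr vbar)
  let P := (mu (vbar.adicCompletion K) n).tateDualPairing n
  let α : (ρ.toLocal (Sum.inr vbar)).toTopRep ⟶ ((mu (vbar.adicCompletion K) n).tateDual n).toTopRep :=
    TopRep.ofHom ⟨⟨(AddMonoidHom.mk' (scalarEnd (vbar.adicCompletion K) (n := n))
        (scalarEnd_add (vbar.adicCompletion K))).toIntLinearMap, continuous_of_discreteTopology⟩, fun σ ↦ by
      refine ContinuousLinearMap.ext fun x ↦ ?_
      change scalarEnd (vbar.adicCompletion K) (ρ (absGaloisRestrict K (vbar.adicCompletion K) σ) x) =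
        (mu (vbar.adicCompletion K) n).tateDual n σ (scalarEnd (vbar.adicCompletion K) x)
      rw [hloc, tateDual_scalarEnd]⟩
  let β : ((ρ.tateDual n).toLocal (Sum.inr vbar)).toTopRep ⟶ (mu (vbar.adicCompletion K) n).toTopRep :=
    TopRep.ofHom ⟨⟨((muTransfer K (vbar.adicCompletion K) n).comp (tateDualEval K (ZMod n) n 1)).toIntLinearMap,
        continuous_of_discreteTopology⟩, fun σ ↦ by
      refine ContinuousLinearMap.ext fun f ↦ ?_
      change muTransfer K (vbar.adicCompletion K) n
          (tateDualEval K (ZMod n) n 1 ((ρ.tateDual n) (absGaloisRestrict K (vbar.adicCompletion K) σ) f)) =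
        mu (vbar.adicCompletion K) n σ (muTransfer K (vbar.adicCompletion K) n (tateDualEval K (ZMod n) n 1 f))
      rw [tateDualEval_apply, tateDualEval_apply, tateDual_apply_apply_apply, ← map_inv, hloc, muTransfer_mu]⟩
  have hc : ∀ (x : ZMod n) (f : TateDual K (ZMod n) n),
      (muLocalIso vbar n).hom.hom (P₁.toLin x f) = P.flip.toLin (α.hom x) (β.hom f) := by
    intro x f
    change muTransfer K (vbar.adicCompletion K) n (tateDualEval K (ZMod n) n x f) =
      tateDualEval (vbar.adicCompletion K) (MuCarrier (vbar.adicCompletion K) n) n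
        (muTransfer K (vbar.adicCompletion K) n (tateDualEval K (ZMod n) n 1 f)) (scalarEnd (vbar.adicCompletion K) x)
    rw [tateDualEval_apply, tateDualEval_apply, tateDualEval_apply, scalarEnd_apply]
    change muTransfer K (vbar.adicCompletion K) n (f x) = ((x.val : ℤ)) • muTransfer K (vbar.adicCompletion K) n (f 1)
    have hfx : f x = x.val • f 1 := by
      conv_lhs => rw [← ZMod.natCast_zmod_val x, ← nsmul_one]
      exact map_nsmul f x.val 1
    rw [hfx, natCast_zsmul]
    exact map_nsmul (muTransfer K (vbar.adicCompletion K) n) x.val (f 1)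
  -- naturality: `H²(muLocalIso)(t_χ ∪ loc_v̄ y) = H¹(α) t_χ ∪' H¹(β) loc_v̄ y`
  have hnat := ContPairing.cupProduct_map P₁ P.flip α β (muLocalIso vbar n).hom hc (oneCocycleClass _ tχ)
    (galoisCohomology.localization (ρ.tateDual n) (Sum.inr vbar) 1 (oneCocycleClass _ φY))
  have hα : cohomologyMap α 1 (oneCocycleClass _ tχ) = oneCocycleClass _ (scalarCocycle χ) := by
    rw [cohomologyMap_oneCocycleClass]
    exact congrArg _ (Subtype.ext (ContinuousMap.ext fun σ ↦ rfl))
  -- the transported local class IS the local Kummer class of `zv` (root `ι ζ`)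
  set zvu : (vbar.adicCompletion K)ˣ := Units.mk0 zv hzv0 with hzvu
  have hζn : (Units.map (absClosureEmbedding K (vbar.adicCompletion K) : AlgebraicClosure K →* AlgebraicClosure (vbar.adicCompletion K)) ζ) ^ n =
      Units.map (algebraMap (vbar.adicCompletion K) (AlgebraicClosure (vbar.adicCompletion K)) :
        vbar.adicCompletion K →* AlgebraicClosure (vbar.adicCompletion K)) zvu := by
    ext
    rw [← map_pow, Units.coe_map, Units.coe_map, MonoidHom.coe_coe, MonoidHom.coe_coe, hzvu, Units.val_mk0, hzv]
  let ζN : kummerUnits (vbar.adicCompletion K) n :=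
    ⟨Units.map (absClosureEmbedding K (vbar.adicCompletion K) : AlgebraicClosure K →* AlgebraicClosure (vbar.adicCompletion K)) ζ, fun σ ↦ by
      rw [hζn]
      ext
      rw [Units.coe_smul, Units.coe_map, MonoidHom.coe_coe, smul_algebraMap]⟩
  have hroot : ((kummerUnitsRoot (vbar.adicCompletion K) n zvu : kummerUnits (vbar.adicCompletion K) n) :
      (AlgebraicClosure (vbar.adicCompletion K))ˣ) ^ n = ((ζN : kummerUnits (vbar.adicCompletion K) n) : (AlgebraicClosure (vbar.adicCompletion K))ˣ) ^ n := by
    rw [kummerUnitsRoot_pow]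
    exact hζn.symm
  have hβ : cohomologyMap β 1 (galoisCohomology.localization (ρ.tateDual n) (Sum.inr vbar) 1 (oneCocycleClass _ φY)) =
      Multiplicative.toAdd (kummerMap (vbar.adicCompletion K) n zvu) := by
    rw [kummerMap_apply, kummerClassHom_eq_of_pow_eq _ n hroot, kummerClassHom_apply, toAdd_ofAdd,
      LayerShapiro.localization_inr_oneCocycleClass vbar (ρ.tateDual n) φY]
    erw [cohomologyMap_oneCocycleClass]
    congr 1
    refine Subtype.ext (ContinuousMap.ext fun σ ↦ muVal_injective (vbar.adicCompletion K) n ?_)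
    change muVal (vbar.adicCompletion K) n (muTransfer K (vbar.adicCompletion K) n
      (tateDualEval K (ZMod n) n 1 (φY.1 (absGaloisRestrict K (vbar.adicCompletion K) σ)))) =
      muVal (vbar.adicCompletion K) n (kummerOneCocycleFun (vbar.adicCompletion K) n ζN σ)
    rw [muVal_kummerOneCocycleFun, tateDualEval_apply, muVal_muTransfer, hread, map_div]
    congr 1
    ext
    rw [Units.coe_map, MonoidHom.coe_coe, Units.coe_smul, absGaloisRestrict_apply_smul, Units.coe_smul, Units.coe_map, MonoidHom.coe_coe]
  -- read the dual condition through `canonical_v̄ = invLevel ∘ H²(muLocalIso)`, graded commutativity and the transport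
  rw [localTatePairingZMod_apply, LocalInvariants.canonical_inr, localInvariantMap_apply] at hval
  have hz : (cohomologyMap (muLocalIso vbar n).hom 2) (P₁.cupProduct (oneCocycleClass _ tχ)
      (galoisCohomology.localization (ρ.tateDual n) (Sum.inr vbar) 1 (oneCocycleClass _ φY))) = 0 :=
    (isInvariantMap_invLevel (vbar.adicCompletion K) n).1.1 (hval.trans (map_zero _).symm)
  have hz2 : P.flip.cupProduct (oneCocycleClass _ (scalarCocycle χ)) (Multiplicative.toAdd (kummerMap (vbar.adicCompletion K) n zvu)) = 0 := by
    rw [← hα, ← hβ]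
    exact hnat.symm.trans hz
  have hcomm := ContPairing.cupProduct_comm P (Multiplicative.toAdd (kummerMap (vbar.adicCompletion K) n zvu))
    (oneCocycleClass _ (scalarCocycle χ))
  have hzero : P.cupProduct (Multiplicative.toAdd (kummerMap (vbar.adicCompletion K) n zvu)) (oneCocycleClass _ (scalarCocycle χ)) = 0 := by
    rw [hcomm, neg_eq_zero]
    exact hz2
  have hbr : Multiplicative.toAdd (kummerMap (vbar.adicCompletion K) n zvu) =
      (isSES_kummer (vbar.adicCompletion K) n (NeZero.pos n)).δ₀ (baseUnitsInvariant (vbar.adicCompletion K) zv hzv0) := by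
    rw [δ₀_baseUnitsInvariant_eq_toAdd_kummerMap]
  rw [hbr] at hzero
  have hdvd := (cupProduct_δ₀_scalarCocycle_eq_zero_iff_dvd_ord (vbar.adicCompletion K) χ hIχ hFχ _ hzv0).mp hzero
  exact dvd_log_valued_of_dvd_ord K vbar hzv0 hdvd

end Local

end Summit.BirchSwinnertonDyer.BirchSwinnertonDyer.Theorems.PrintCf2.NormAtVbar

end
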